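import Summits.BirchSwinnertonDyer.BirchSwinnertonDyer.Theorems.KolyvaginDepthDoorDepthTableKuriharaDecisivePrime
import Summits.BirchSwinnertonDyer.BirchSwinnertonDyer.Theorems.KolyvaginDepthDoorDepthTableKuriharaSocket709a1
import Summits.BirchSwinnertonDyer.Rank1Residual.Supersingular.CountPointsFast
import HarnessLib

/-!
# Route `KolyvaginDepthDoor`, crux `KolyvaginDepthSupplyKN` (stmt-BirchSwinnertonDyer-22820) —
# DEPTH TABLE v19, ROW `709a1` @ `(5, d_K = −7)`: THE DECISIVE PRIME `ℓ★ = 71` — the row's bit ⟺ a unit mod-`5`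
# Kurihara number of the twist model `T₀ = [0, 1, 1, -114, 130]` AT THE ONE PRIME `71` (kernel: `16 • P̄ ≠ O` in
# `T̃₀(𝔽₇₁)` for `P = (−5, 24)`, `#T̃₀(𝔽₇₁) = 80 = 5·16`)

Helper file of the lead prover of line `levelone` (kdd-p1 g23; `--supports stmt-BirchSwinnertonDyer-22820
--as helper`); it closes nothing and BSD is NOT proved by it.

v18 (g22, `…KuriharaSocket709a1`) read the row EXACTLY as «bit ⟺ SOME cyclic Kolyvagin prime `ℓ` of `(T₀, 5)`
carries a unit `δ̃_ℓ(T₀)`» and CLOSING-DATA-v18 §2b marked `ℓ = 71` with ★ (the known point `P = (−5, 24)` of `T₀`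
is not divisible by `5` in `T̃₀(𝔽₇₁)` — a HEURISTIC there). v19 makes the ★ a THEOREM-LEVEL statement: by the generic
`…KuriharaDecisivePrime` (Sakamoto 2022 Lemma 4.4 + Lemma 4.6 (1) BY NAME, `hSak3`), the bit — which gives
`#Sel_5(E^{(−7)}) ≤ 5` by g14/g20's exact reading `exactRowZhang_5_neg7_rankFree` — FORCES `δ̃_71(T₀) ≢ 0 (mod 5)`,
the local `5`-indivisibility of `P` at `71` being KERNEL-CHECKED here (`minTwist7_localNondivisible_71`: the affine
doubling chain `P̄ → 2P̄ → 4P̄ → 8P̄ → 16P̄ = (70, 42) ≠ O` in `T̃₀(𝔽₇₁)` by `decide`, `5·16 = #T̃₀(𝔽₇₁) = 80`, and the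
bridge `localNondivisible_of_chainB`). Conversely a unit at `71` closes the row by the socket. HENCE

* `twistKuriharaBit_iff_unit_71` — **bit ⟺ unit `δ̃_71(T₀)`** (for every admissible datum of `T₀`): the fleet's ONE
  residue `δ̃_71(T₀) mod 5` DECIDES the row `709a1` @ `(5, −7)` BOTH WAYS modulo print — a computed ZERO refutes the
  crux's clause at `(5, ℚ(√−7))` for `709a1` (the row then moves to `p ∈ {7, 11, 13}`), a UNIT proves it.

Kernel lemmas: `minTwist7_card_71` (`#T̃₀(𝔽₇₁) = 80`, `a_71(T₀) = −8 ≡ 2 (mod 5)`), `minTwist7_isCyclicKolyvaginLevel_5_71`,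
`minTwist7_localNondivisible_71`. CONDITIONAL on the named facts displayed (`h372`, `h84`, `hKim`, `hSak1`, `hSak2`, `hSak3`,
`hnf`, `hMaz`) and the E-side record claim `hδE`; per curve; nothing class-wide; BSD is NOT proved by any of this.

References: [Sakamoto2022pSelmer] Lemma 4.4, Lemma 4.6 (1), Thm. 1.2, Thm. 1.5; [Kim2022StructureSelmer] Thm. 1.11;
[Kurihara2014] §5.3; [WZhang2014] Lemma 8.4 (1); [GrossLMS1991] Prop. 3.7 (2); [SilvermanAEC2009] III.2.3, VII.2.1, VII.3.1;
[CremonaAlgorithms1997] Table 1 (709a1).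
-/

set_option linter.dupNamespace false

noncomputable section

open scoped Classical NumberField

namespace Summit.BirchSwinnertonDyer.BirchSwinnertonDyer.Theorems.KolyvaginDepthDoor

open Literature.NumberTheory.EllipticCurves Literature.NumberTheory.EllipticCurves.ModularForms
  WeierstrassCurve NumberField IsDedekindDomain
open Summit.BirchSwinnertonDyer.BirchSwinnertonDyer.Theorems
open Summit.BirchSwinnertonDyer.BirchSwinnertonDyer.Rank2Observatory
open Summit.BirchSwinnertonDyer.BirchSwinnertonDyer.Rank1Residual (IntModel.frobeniusTrace_eq)
open Summit.BirchSwinnertonDyer.Rank1Residual.Supersingular (natCard_point_eq_of_countPoints countPoints_eq_of_fast)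
open Summit.BirchSwinnertonDyer.Rank1Residual.Additive (card_torsion_le_of_intModel_of_card
  isKolyvaginPrime_of_intModel_of_card)

namespace C709a1

/-- `#T̃₀(𝔽₇₁) = 80 = 5·16` for `T₀ = [0, 1, 1, -114, 130]` (`71 ≡ 1 (mod 5)`, `a_71(T₀) = −8 ≡ 2 (mod 5)`, `25 ∤ 80`),
kernel-decided (`countPointsFast`). [cite: Kim2022StructureSelmer, §1.2.2 (PDF p. 5)] -/
theorem minTwist7_card_71 :
    Nat.card (((⟨0, 1, 1, -114, 130⟩ : WeierstrassCurve ℤ).map (Int.castRingHom (ZMod 71))).toAffine.Point) = 80 :=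
  haveI : Fact (Nat.Prime 71) := ⟨by norm_num⟩
  natCard_point_eq_of_countPoints 0 1 1 (-114) 130 71 (by norm_num) (by decide +kernel) (n := 80)
    (countPoints_eq_of_fast (by decide +kernel))

/-- **`71` is a CYCLIC KOLYVAGIN PRIME for `(T₀, 5)`** (`71 ∤ 5·N_{T₀}`, `71 ≡ 1`, `a_71(T₀) ≡ 2 (mod 5)`,
`#T̃₀(𝔽₇₁)[5] ≤ 5`) — the first ★ candidate of CLOSING-DATA-v18 §2b. [cite: Kim2022StructureSelmer, §1.2.2 (PDF p. 5)] -/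
theorem minTwist7_isCyclicKolyvaginLevel_5_71 :
    haveI := minTwist7_isGloballyMinimal; haveI := Fact.mk (by norm_num : Nat.Prime 5);
    IsCyclicKolyvaginLevel ((⟨0, 1, 1, -114, 130⟩ : WeierstrassCurve ℤ).map (Int.castRingHom ℚ)) 5 71 := by
  haveI := minTwist7_isElliptic
  haveI := minTwist7_isGloballyMinimal
  haveI := Fact.mk (by norm_num : Nat.Prime 5)
  haveI : Fact (Nat.Prime 71) := ⟨by norm_num⟩
  have h71 : Kato.IsKolyvaginPrime ((⟨0, 1, 1, -114, 130⟩ : WeierstrassCurve ℤ).map (Int.castRingHom ℚ)) 5 1 71 :=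
    isKolyvaginPrime_of_intModel_of_card minTwist7_intModel 5 1 71 (by norm_num) (by decide +kernel) (by decide)
      minTwist7_card_71 (by norm_num)
  refine ⟨⟨Nat.squarefree_iff_nodup_primeFactorsList (by norm_num) |>.mpr (by simp), fun ℓ hℓ ↦ ?_⟩, fun ℓ hℓ hdvd ↦ ?_⟩
  · rw [show (71 : ℕ).primeFactors = {71} from (Nat.Prime.primeFactors (by norm_num)), Finset.mem_singleton] at hℓ
    exact hℓ ▸ h71
  · obtain rfl := (Nat.prime_dvd_prime_iff_eq hℓ.out (by norm_num)).mp hdvd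
    exact card_torsion_le_of_intModel_of_card minTwist7_intModel 5 71 minTwist7_card_71 (by norm_num)

/-- The rational point `P = (−5, 24)` of `T₀ = [0, 1, 1, -114, 130]` (`24² + 24 = 600 = −125 + 25 + 570 + 130`). [folklore] -/
theorem minTwist7_nonsingular_P :
    ((⟨0, 1, 1, -114, 130⟩ : WeierstrassCurve ℤ).map (Int.castRingHom ℚ)).toAffine.Nonsingular ((-5 : ℤ) : ℚ) ((24 : ℤ) : ℚ) :=
  nonsingular_rat_of_eq _ (by decide +kernel) (by norm_num)

/-- The doubling chain `P̄ → 2P̄ → 4P̄ → 8P̄ → 16P̄` reaches the multiplier `16`. [folklore] -/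
theorem chain71_mult :
    chainMult 1 [(true, ((10 : ℤ) : ZMod 71), ((61 : ℤ) : ZMod 71)), (true, ((70 : ℤ) : ZMod 71), ((28 : ℤ) : ZMod 71)),
      (true, ((10 : ℤ) : ZMod 71), ((9 : ℤ) : ZMod 71)), (true, ((70 : ℤ) : ZMod 71), ((42 : ℤ) : ZMod 71))] = 16 := by
  decide

/-- The doubling chain `(66, 24) → (10, 61) → (70, 28) → (10, 9) → (70, 42)` in `T̃₀(𝔽₇₁)` CHECKS (tangent certificates,
`decide`). [cite: SilvermanAEC2009, III.2.3] -/
theorem chain71_ok :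
    chainB (⟨0, 1, 1, -114, 130⟩ : WeierstrassCurve ℤ) 71 (((-5 : ℤ)) : ZMod 71) (((24 : ℤ)) : ZMod 71)
      ((((-5 : ℤ)) : ZMod 71), (((24 : ℤ)) : ZMod 71))
      [(true, ((10 : ℤ) : ZMod 71), ((61 : ℤ) : ZMod 71)), (true, ((70 : ℤ) : ZMod 71), ((28 : ℤ) : ZMod 71)),
      (true, ((10 : ℤ) : ZMod 71), ((9 : ℤ) : ZMod 71)), (true, ((70 : ℤ) : ZMod 71), ((42 : ℤ) : ZMod 71))] = true := by
  decide +kernel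

/-- **KERNEL: `P = (−5, 24)` is not divisible by `5` in `T₀(ℚ₇₁)`** — the doubling chain `P̄ = (66, 24) → (10, 61) →
(70, 28) → (10, 9) → (70, 42) = 16 • P̄ ≠ O` in `T̃₀(𝔽₇₁)` (`decide` on `Rank2Observatory.chainB`), `5·16 = #T̃₀(𝔽₇₁)`,
and `localNondivisible_of_chainB`. This is the ★ of CLOSING-DATA-v18 §2b for `709a1` at `71`, now in the kernel.
[cite: SilvermanAEC2009, III.2.3, VII.2 Prop. 2.1, VII.3 Prop. 3.1] -/
theorem minTwist7_localNondivisible_71 :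
    haveI : Fact (Nat.Prime 71) := ⟨by norm_num⟩;
    ∀ Q : (((⟨0, 1, 1, -114, 130⟩ : WeierstrassCurve ℤ).map (Int.castRingHom ℚ)).baseChange ℚ_[71]).toAffine.Point,
      5 • Q ≠ WeierstrassCurve.Affine.Point.map (W' := ((⟨0, 1, 1, -114, 130⟩ : WeierstrassCurve ℤ).map (Int.castRingHom ℚ)).toAffine)
        (S := ℚ) (Algebra.ofId ℚ ℚ_[71]) (.some ((-5 : ℤ) : ℚ) ((24 : ℤ) : ℚ) minTwist7_nonsingular_P) := by
  haveI : Fact (Nat.Prime 71) := ⟨by norm_num⟩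
  have hq : ¬ ((71 : ℕ) : ℤ) ∣ (⟨0, 1, 1, -114, 130⟩ : WeierstrassCurve ℤ).Δ := by decide +kernel
  have hXY : (⟨0, 1, 1, -114, 130⟩ : WeierstrassCurve ℤ).toAffine.Equation (-5) 24 :=
    (Affine.equation_iff _ _).mpr (by norm_num)
  have hpk : 5 * 16 = Nat.card (((⟨0, 1, 1, -114, 130⟩ : WeierstrassCurve ℤ).map (Int.castRingHom (ZMod 71))).toAffine.Point) := by
    rw [minTwist7_card_71]
  exact localNondivisible_of_chainB (⟨0, 1, 1, -114, 130⟩ : WeierstrassCurve ℤ) 71 hq hXY minTwist7_nonsingular_P hpk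
    chain71_mult (by convert chain71_ok)

/-- **ROW `709a1` @ `(5, −7)`: THE DECISIVE PRIME `71` — bit ⟺ unit `δ̃_71(T₀)`.** For every imaginary quadratic `K`
with `d_K = −7`, granted (γ) (`h372`), W. Zhang L8.4 (1)/9.1 (`h84`), Kim Thm. 1.11 (`hKim`), Sakamoto Thm. 1.5 / 1.2 /
L4.4+L4.6 (`hSak1`, `hSak2`, `hSak3`), modularity (`hnf`), Mazur Cor. 4.1 (`hMaz`) BY NAME and the E-side record claim
`hδE` (`cert_709a1` @ `(5, 71·101)`): «some frame, some Kolyvagin PRIME `ℓ`, some Kolyvagin–Heegner datum of conductor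
`ℓ` with `c_1(ℓ) ≠ 0`» (the depth-table bit) holds IF AND ONLY IF «every datum `D` of `T₀ = [0, 1, 1, -114, 130]` at level
`N_{T₀}` with `5 ∤ c_D` and the period transfer has a UNIT mod-`5` Kurihara number AT `71`» — the claim of a future tree
record `cert_<T₀>` @ `(5, 71)`. (⟹): bit ⟹ `#Sel_5(E^{(−7)}) ≤ 5` (`exactRowZhang_5_neg7_rankFree`) ⟹ unit at `71`
(`twistKuriharaClaim_prime_of_natCard_selmerGroup_le` with the kernel certificate `minTwist7_localNondivisible_71`);
(⟸): the socket/exact reading `kolyvaginPrime_iff_twistKuriharaBit_5_neg7` with `m = 71`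
(`minTwist7_isCyclicKolyvaginLevel_5_71`, `ν(71) = 1`). CONDITIONAL on the eight named facts and the claim; per curve; BSD
is not proved by it. [cite: Sakamoto2022pSelmer, Lemma 4.4, Lemma 4.6 (1), Thm. 1.2, Thm. 1.5]
[cite: Kim2022StructureSelmer, Thm. 1.11] [cite: WZhang2014, Lemma 8.4 (1) (p. 236)] [cite: GrossLMS1991, Prop. 3.7 (2)]
[cite: CremonaAlgorithms1997, Table 1 (709a1)] -/
theorem twistKuriharaBit_iff_unit_71
    (h372 : GrossLMS1991.prop37_2_frobeniusCongruence)
    (h84 : Literature.NumberTheory.EllipticCurves.WZhang2014_lemma84_exists_minimal_kolyvaginClass_one_selmerCard)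
    (hKim : Kim2022_card_selmerGroup_le_pow_of_kuriharaNumber_ne_zero)
    (hSak1 : Sakamoto2022_card_selmerGroup_eq_pow_of_isDeltaMinimal)
    (hSak2 : Sakamoto2022_exists_cyclicLevel_kuriharaNumber_ne_zero)
    (hSak3 : Literature.NumberTheory.EllipticCurves.Sakamoto2022_kuriharaNumber_prime_ne_zero_of_localNondivisible)
    (hnf : exists_isNewformOf) (hMaz : mazur_not_dvd_maninConstant_of_odd)
    (K : Type) [Field K] [NumberField K] (hK : IsImaginaryQuadratic K) (hD : NumberField.discr K = -7)
    (hδE : haveI := isElliptic_c709a1; haveI := isGloballyMinimal_c709a1;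
      haveI : NeZero (((⟨0, -1, 1, -2, 0⟩ : WeierstrassCurve ℤ).map (Int.castRingHom ℚ)).conductorNorm ℤ) := neZero_conductorNorm_of_isElliptic _;
      haveI := Fact.mk (by norm_num : Nat.Prime 5);
      ∀ (D : ModularParametrizationData ((⟨0, -1, 1, -2, 0⟩ : WeierstrassCurve ℤ).map (Int.castRingHom ℚ)) (((⟨0, -1, 1, -2, 0⟩ : WeierstrassCurve ℤ).map (Int.castRingHom ℚ)).conductorNorm ℤ)), ¬ ((5 : ℕ) : ℤ) ∣ D.maninConstant →
        (∃ u : ℚ, ‖(u : ℚ_[5])‖ = 1 ∧ ((⟨0, -1, 1, -2, 0⟩ : WeierstrassCurve ℤ).map (Int.castRingHom ℚ)).realPeriodRat = u * plusPeriod D.f) →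
        ∃ ψ : (ℓ : ℕ) → (ZMod ℓ)ˣ →* Multiplicative (ZMod 5),
          (∀ ℓ ∈ (7171 : ℕ).primeFactors, Function.Surjective (ψ ℓ)) ∧ kuriharaNumber D.f 5 7171 ψ ≠ 0) :
    haveI := isElliptic_c709a1; haveI := isGloballyMinimal_c709a1;
    haveI : NeZero (((⟨0, -1, 1, -2, 0⟩ : WeierstrassCurve ℤ).map (Int.castRingHom ℚ)).conductorNorm ℤ) := neZero_conductorNorm_of_isElliptic _;
    haveI := minTwist7_isElliptic; haveI := minTwist7_isGloballyMinimal;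
    haveI : NeZero (((⟨0, 1, 1, -114, 130⟩ : WeierstrassCurve ℤ).map (Int.castRingHom ℚ)).conductorNorm ℤ) := neZero_conductorNorm_of_isElliptic _;
    haveI := Fact.mk (by norm_num : Nat.Prime 5);
    (∃ (Dt : ModularParametrizationData ((⟨0, -1, 1, -2, 0⟩ : WeierstrassCurve ℤ).map (Int.castRingHom ℚ)) (((⟨0, -1, 1, -2, 0⟩ : WeierstrassCurve ℤ).map (Int.castRingHom ℚ)).conductorNorm ℤ)) (β : ℤ)
      (ι : K →+* ℂ) (ℓ : ℕ) (d : KolyvaginHeegnerData Dt β ι ℓ),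
      ℓ.Prime ∧ Zhang2014.IsKolyvaginPrime (((⟨0, -1, 1, -2, 0⟩ : WeierstrassCurve ℤ).map (Int.castRingHom ℚ)).conductorNorm ℤ) ((⟨0, -1, 1, -2, 0⟩ : WeierstrassCurve ℤ).map (Int.castRingHom ℚ)) K 5 ℓ ∧
        d.kolyvaginClass (p := 5) (by norm_num) 1 ≠ 0) ↔
    (∀ (D : ModularParametrizationData ((⟨0, 1, 1, -114, 130⟩ : WeierstrassCurve ℤ).map (Int.castRingHom ℚ))
          (((⟨0, 1, 1, -114, 130⟩ : WeierstrassCurve ℤ).map (Int.castRingHom ℚ)).conductorNorm ℤ)),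
        ¬ ((5 : ℕ) : ℤ) ∣ D.maninConstant →
        (∃ u : ℚ, ‖(u : ℚ_[5])‖ = 1 ∧
          ((⟨0, 1, 1, -114, 130⟩ : WeierstrassCurve ℤ).map (Int.castRingHom ℚ)).realPeriodRat = u * plusPeriod D.f) →
        ∃ ψ : (q : ℕ) → (ZMod q)ˣ →* Multiplicative (ZMod 5),
          (∀ q ∈ (71 : ℕ).primeFactors, Function.Surjective (ψ q)) ∧ kuriharaNumber D.f 5 71 ψ ≠ 0) := by
  haveI := isElliptic_c709a1
  haveI := isGloballyMinimal_c709a1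
  haveI iNZ : NeZero (((⟨0, -1, 1, -2, 0⟩ : WeierstrassCurve ℤ).map (Int.castRingHom ℚ)).conductorNorm ℤ) :=
    neZero_conductorNorm_of_isElliptic _
  haveI := minTwist7_isElliptic
  haveI := minTwist7_isGloballyMinimal
  haveI iNZT : NeZero (((⟨0, 1, 1, -114, 130⟩ : WeierstrassCurve ℤ).map (Int.castRingHom ℚ)).conductorNorm ℤ) :=
    neZero_conductorNorm_of_isElliptic _
  haveI iP := Fact.mk (by norm_num : Nat.Prime 5)
  haveI : Fact (Nat.Prime 71) := ⟨by norm_num⟩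
  haveI : NeZero (71 : ℕ) := ⟨by norm_num⟩
  have hsur : ((⟨0, -1, 1, -2, 0⟩ : WeierstrassCurve ℤ).map (Int.castRingHom ℚ)).HasSurjectiveModNGaloisRep ((5 : ℕ) : ℤ) := by
    simpa using hasSurjectiveModNGaloisRep_pow_5 1
  have hC : (⟨1, (2 : ℚ), (0 : ℚ), -((1 : ℚ) / 2)⟩ : WeierstrassCurve.VariableChange ℚ) •
      ((⟨0, 1, 1, -114, 130⟩ : WeierstrassCurve ℤ).map (Int.castRingHom ℚ)) =
      ((⟨0, -1, 1, -2, 0⟩ : WeierstrassCurve ℤ).map (Int.castRingHom ℚ)).quadraticTwist ((NumberField.discr K : ℤ) : ℚ) := by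
    rw [hD]; push_cast; exact minTwist7_smul_eq
  have hpD : ¬ (((5 : ℕ) : ℤ) ∣ NumberField.discr K) := by rw [hD]; decide
  constructor
  · intro hbit D hc hu
    have hle := ((exactRowZhang_5_neg7_rankFree h372 h84 K hK hD).mp hbit).2
    exact twistKuriharaClaim_prime_of_natCard_selmerGroup_le hSak3 _ 5 le_rfl goodOrdinary_5.1 goodOrdinary_5.2 hsur
      (NumberField.discr_ne_zero K) hpD _ _ hC minTwist7_nonAnomalous_5 minTwist7_kodairaNeron_5 hle 71
      minTwist7_isCyclicKolyvaginLevel_5_71 _ minTwist7_localNondivisible_71 D hc hu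
  · intro hunit
    refine (kolyvaginPrime_iff_twistKuriharaBit_5_neg7 h372 h84 hKim hSak1 hSak2 hnf hMaz K hK hD hδE).mpr fun D hc hu ↦ ?_
    obtain ⟨ψ, hψ, hne⟩ := hunit D hc hu
    refine ⟨71, inferInstance, minTwist7_isCyclicKolyvaginLevel_5_71, ?_, ψ, hψ, hne⟩
    rw [Nat.Prime.primeFactors (by norm_num), Finset.card_singleton]

end C709a1

end Summit.BirchSwinnertonDyer.BirchSwinnertonDyer.Theorems.KolyvaginDepthDoor

end
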